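import Mathlib.ModelTheory.Algebra.Ring.Basic
import Mathlib.Analysis.SpecialFunctions.Pow.Real
import Mathlib.Algebra.Field.ZMod
import Mathlib.Data.ZMod.Basic
import Mathlib.SetTheory.Cardinal.Finite
import HarnessLib

/-!
# Definable sets over finite fields: the Chatzidakis–van den Dries–Macintyre counting theorem

This file vendors, as a NAMED FACT, the Main Theorem of Chatzidakis, van den Dries and Macintyre,
*Definable sets over finite fields*, J. reine angew. Math. **427** (1992) 107–135
(bib key ChatzidakisVanDenDriesMacintyre1992): for every formula `φ(x̄; ȳ)` of the language of rings
(`x̄ = (x₁,…,x_m)` the set variables, `ȳ = (y₁,…,y_n)` the parameter variables) there are a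
constant `C > 0` and a FINITE set `D` of pairs `(d, μ)`, `d ∈ {0,…,m}`, `μ ∈ ℚ_{>0}`, such that
for every finite field `𝔽_q` and every `ā ∈ 𝔽_q^n` the definable set
`φ(𝔽_q^m; ā) = {x̄ ∈ 𝔽_q^m | 𝔽_q ⊨ φ(x̄, ā)}` is either empty or satisfies
`| |φ(𝔽_q^m; ā)| − μ q^d | ≤ C q^{d − 1/2}` for some `(d, μ) ∈ D`.

The original paper is not held (acquisition request acq-02249); the statement vendored here is
the one restated verbatim in two held secondary sources:

* D. Macpherson, C. Steinhorn, *Definability in classes of finite structures*, in: Finite and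
  Algorithmic Model Theory (CUP 2011), **Theorem 4.2.1** (bib key MacphersonSteinhorn2011;
  `d ∈ {0,…,n}`,
  `μ` a non-negative rational, the estimate `(*)` for some `(d, μ) ∈ D`);
* E. Kowalski, *Exponential sums over definable subsets of finite fields*, Israel J. Math. 160
  (2007), **Corollary 13 (Chatzidakis–van den Dries–Macintyre)** with Theorem 12 (bib key
  Kowalski2007)
  (`|φ(𝔽_q, y)| = μ(y) q^{δ(y)} + O(q^{δ(y) − 1/2})`, `μ(y) ∈ ℚ` is `> 0` unless
  `φ(𝔽_q, y) = ∅`, the implied constant depends only on `φ`, only finitely many pairs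
  `(δ(y), μ(y))` occur, and `δ(y) ≤ n` = the number of set variables).

We state the "empty or (estimate with `μ > 0`)" form (CDM / Kowalski); the Macpherson–Steinhorn
form with `μ ≥ 0` follows by adding the pair `(0, 0)`.

## Main declarations

* `definableCard K φ c : ℕ` — the number of points of the definable set `φ(K^m; c)` of a ring `K`
  (as `Nat.card`; `K` is made an `L_ring`-structure by `FirstOrder.Ring.compatibleRingOfRing`),
  with the unfolding lemmas `definableCard_eq_card_filter` (the `Finset.filter` form used by the
  P ≠ NP route `EcdlpDefinability`) and the trivial bound `definableCard_le_card_pow`.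
* `ChatzidakisVanDenDriesMacintyre1992_mainTheorem : Prop` — the named fact (all finite fields
  `K : Type`; every finite field is isomorphic to one in `Type`, e.g. `GaloisField p k`).
* `ChatzidakisVanDenDriesMacintyre1992_mainTheorem.primeField` — PROVED specialisation to the
  prime fields `ZMod p`, in the `Finset.filter` typing of the route.
* `ChatzidakisVanDenDriesMacintyre1992_mainTheorem.card_le_or_le` — PROVED corollary, the size
  dichotomy "a definable set of fixed complexity has `≤ C'` or `≥ δ·q` points" (the shape of the
  route crux `DefinableSizeDichotomy`), and its prime-field form `.card_filter_le_or_le`.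

## Not vendored here

* the supplement of the Main Theorem that for each `(d, μ) ∈ D` the set of parameters `ā` for
  which `(*)` holds with `(d, μ)` is `∅`-definable uniformly in `𝔽_q`
  (MacphersonSteinhorn2011, Thm 4.2.1, "Furthermore …"; Kowalski2007, Cor. 13 (3));
* Kowalski's geometric decomposition of definable sets (Kowalski2007, Thm 8) (schemes
  `W_{κ,i}/ℤ` with maps `π_{κ,i}`, `τ_{κ,i}`); the arXiv text of its clause (3) is ambiguous about
  which fibres have `≤ e` points, so it should be vendored from the published version;
* the proof (Kiefe's near model completeness + Lang–Weil); Mathlib has neither Lang–Weil nor the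
  Riemann hypothesis for curves over finite fields, so no discharge is attempted.
-/

namespace Literature.ModelTheory.PseudofiniteFields

open FirstOrder FirstOrder.Language FirstOrder.Ring

/-- `definableCard K φ c`: for a ring `K` (only its `+,·,−,0,1` are used), a formula `φ` of the
language of rings in the free variables `Fin m ⊕ Fin n` (first block: the set variables `x̄`;
second block: the parameter variables `ȳ`) and parameters `c : Fin n → K`, the number of points
`|φ(K^m; c)| = |{x̄ ∈ K^m | K ⊨ φ(x̄, c)}|` of the definable set (as `Nat.card`, hence `0` if the
set is infinite). `K` is regarded as an `L_ring`-structure through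
`FirstOrder.Ring.compatibleRingOfRing`. [cite: Kowalski2007, §2 eq. (2.1) and §3] -/
noncomputable def definableCard (K : Type*) [Add K] [Mul K] [Neg K] [One K] [Zero K]
    {m n : ℕ} (φ : Language.ring.Formula (Fin m ⊕ Fin n)) (c : Fin n → K) : ℕ :=
  letI := compatibleRingOfRing K
  Nat.card {x : Fin m → K // φ.Realize (Sum.elim x c)}

/-- Unfolding lemma for `definableCard`. [folklore] -/
theorem definableCard_def (K : Type*) [Add K] [Mul K] [Neg K] [One K] [Zero K]
    {m n : ℕ} (φ : Language.ring.Formula (Fin m ⊕ Fin n)) (c : Fin n → K) :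
    definableCard K φ c =
      (letI := compatibleRingOfRing K; Nat.card {x : Fin m → K // φ.Realize (Sum.elim x c)}) :=
  rfl

open Classical in
/-- Over a finite ring, `definableCard` is the cardinality of the `Finset` of realizations
(the typing used in `Summit.PneNP.PneNP.Theses.EcdlpDefinability`). [folklore] -/
theorem definableCard_eq_card_filter (K : Type*) [Add K] [Mul K] [Neg K] [One K] [Zero K]
    [Fintype K] {m n : ℕ} (φ : Language.ring.Formula (Fin m ⊕ Fin n)) (c : Fin n → K) :
    definableCard K φ c =
      (letI := compatibleRingOfRing K;
        (Finset.univ.filter fun x : Fin m → K => φ.Realize (Sum.elim x c)).card) := by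
  letI := compatibleRingOfRing K
  rw [definableCard_def, Nat.card_eq_fintype_card, Fintype.card_subtype]

/-- Trivial bound: a definable subset of `K^m` has at most `|K|^m` points. [folklore] -/
theorem definableCard_le_card_pow (K : Type*) [Add K] [Mul K] [Neg K] [One K] [Zero K]
    [Fintype K] {m n : ℕ} (φ : Language.ring.Formula (Fin m ⊕ Fin n)) (c : Fin n → K) :
    definableCard K φ c ≤ Fintype.card K ^ m := by
  letI := compatibleRingOfRing K
  rw [definableCard_def]
  calc Nat.card {x : Fin m → K // φ.Realize (Sum.elim x c)}
      ≤ Nat.card (Fin m → K) := Finite.card_subtype_le _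
    _ = Fintype.card K ^ m := by
        rw [Nat.card_eq_fintype_card, Fintype.card_fun, Fintype.card_fin]

/-- **Chatzidakis–van den Dries–Macintyre, Main Theorem** (counting points of definable sets over
finite fields). For every formula `φ(x̄; ȳ)` of the language of rings with set variables
`x̄ = (x₁,…,x_m)` and parameter variables `ȳ = (y₁,…,y_n)` there exist a constant `C > 0` and a
finite set `D` of pairs `(d, μ)` with `d ∈ {0,…,m}` and `μ` a positive rational such that for
every finite field `K = 𝔽_q` and every `ā ∈ K^n`, the definable set `φ(K^m; ā)` is empty or
`| |φ(K^m; ā)| − μ·q^d | ≤ C·q^{d − 1/2}` for some `(d, μ) ∈ D`.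
Stated for finite fields in `Type` (no loss: every finite field is isomorphic to some
`GaloisField p k : Type`). The original is Chatzidakis–van den Dries–Macintyre 1992, Main
Theorem; vendored from the restatements (MacphersonSteinhorn2011, Thm 4.2.1) and
(Kowalski2007, Cor. 13 with Thm 12): positivity of `μ` for nonempty sets, finiteness of the set of
pairs, `d ≤ m`. [cite: ChatzidakisVanDenDriesMacintyre1992, Main Theorem] -/
def ChatzidakisVanDenDriesMacintyre1992_mainTheorem : Prop :=
  ∀ (m n : ℕ) (φ : Language.ring.Formula (Fin m ⊕ Fin n)),
    ∃ (C : ℝ) (D : Finset (ℕ × ℚ)), 0 < C ∧ (∀ dμ ∈ D, dμ.1 ≤ m ∧ 0 < dμ.2) ∧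
      ∀ (K : Type) [Field K] [Fintype K] (c : Fin n → K),
        definableCard K φ c = 0 ∨
          ∃ dμ ∈ D, |(definableCard K φ c : ℝ) - (dμ.2 : ℝ) * (Fintype.card K : ℝ) ^ dμ.1|
              ≤ C * (Fintype.card K : ℝ) ^ ((dμ.1 : ℝ) - 1 / 2)

open Classical in
/-- Prime-field form of the CDM Main Theorem, in the `Finset.filter` typing of the P ≠ NP route
`EcdlpDefinability`: for every ring formula `φ(x̄; ȳ)` there are `C > 0` and a finite set `D` of
pairs `(d, μ)` (`d ≤ m`, `μ ∈ ℚ_{>0}`) such that for every prime `p` and all parameters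
`c ∈ 𝔽_p^n` the set `φ(𝔽_p^m; c)` is empty or `| |φ(𝔽_p^m; c)| − μ p^d | ≤ C p^{d − 1/2}` for some
`(d, μ) ∈ D`. Immediate from the fact with `K = ZMod p`, `|ZMod p| = p`.
[cite: ChatzidakisVanDenDriesMacintyre1992, Main Theorem] -/
theorem ChatzidakisVanDenDriesMacintyre1992_mainTheorem.primeField
    (h : ChatzidakisVanDenDriesMacintyre1992_mainTheorem) (m n : ℕ)
    (φ : Language.ring.Formula (Fin m ⊕ Fin n)) :
    ∃ (C : ℝ) (D : Finset (ℕ × ℚ)), 0 < C ∧ (∀ dμ ∈ D, dμ.1 ≤ m ∧ 0 < dμ.2) ∧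
      ∀ (p : ℕ) [Fact p.Prime] (c : Fin n → ZMod p),
        (letI := compatibleRingOfRing (ZMod p);
          (Finset.univ.filter fun x : Fin m → ZMod p => φ.Realize (Sum.elim x c)).card = 0 ∨
            ∃ dμ ∈ D,
              |((Finset.univ.filter fun x : Fin m → ZMod p => φ.Realize (Sum.elim x c)).card : ℝ)
                  - (dμ.2 : ℝ) * (p : ℝ) ^ dμ.1| ≤ C * (p : ℝ) ^ ((dμ.1 : ℝ) - 1 / 2)) := by
  obtain ⟨C, D, hC, hD, hmain⟩ := h m n φ
  refine ⟨C, D, hC, hD, fun p _ c => ?_⟩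
  have h := hmain (ZMod p) c
  rw [definableCard_eq_card_filter, ZMod.card] at h
  exact h

/-- **Size dichotomy for definable sets** (corollary of the CDM Main Theorem): for every ring
formula `φ(x̄; ȳ)` there are `C'` and `δ > 0` such that for every finite field `K = 𝔽_q` and all
parameters, `|φ(K^m; c)| ≤ C'` or `|φ(K^m; c)| ≥ δ·q` — "first-order logic over finite fields sees
no sets of intermediate size". Proof: with `(C, D)` from the Main Theorem, `μ₀ = min μ`,
`μ₁ = max μ`: a pair with `d = 0` gives `≤ μ₁ + C`; a pair with `d ≥ 1` gives
`≥ μ q^d − C q^{d−1/2} ≥ (μ/2) q^d ≥ (μ₀/2) q` once `√q ≥ 2C/μ`, and otherwise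
`q < (2C/μ₀)²` so the set has `≤ q^m ≤ (2C/μ₀)^{2m}` points.
[cite: MacphersonSteinhorn2011, discussion after Thm 4.2.1] -/
theorem ChatzidakisVanDenDriesMacintyre1992_mainTheorem.card_le_or_le
    (h : ChatzidakisVanDenDriesMacintyre1992_mainTheorem) (m n : ℕ)
    (φ : Language.ring.Formula (Fin m ⊕ Fin n)) :
    ∃ C δ : ℝ, 0 < δ ∧ ∀ (K : Type) [Field K] [Fintype K] (c : Fin n → K),
      (definableCard K φ c : ℝ) ≤ C ∨ δ * (Fintype.card K : ℝ) ≤ (definableCard K φ c : ℝ) := by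
  obtain ⟨C, D, hC, hD, hmain⟩ := h m n φ
  -- a positive lower bound `μ₀` and an upper bound `μ₁ ≥ 0` for the measures `μ` occurring in `D`
  obtain ⟨μ₀, hμ₀, hμ₀le⟩ : ∃ μ₀ : ℝ, 0 < μ₀ ∧ ∀ dμ ∈ D, μ₀ ≤ (dμ.2 : ℝ) := by
    by_cases hne : D.Nonempty
    · obtain ⟨a, ha, hmin⟩ := D.exists_min_image (fun dμ => (dμ.2 : ℝ)) hne
      exact ⟨a.2, by exact_mod_cast (hD a ha).2, fun dμ hdμ => hmin dμ hdμ⟩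
    · exact ⟨1, one_pos, fun dμ hdμ => (hne ⟨dμ, hdμ⟩).elim⟩
  obtain ⟨μ₁, hμ₁, hμ₁le⟩ : ∃ μ₁ : ℝ, 0 ≤ μ₁ ∧ ∀ dμ ∈ D, (dμ.2 : ℝ) ≤ μ₁ := by
    by_cases hne : D.Nonempty
    · obtain ⟨a, ha, hmax⟩ := D.exists_max_image (fun dμ => (dμ.2 : ℝ)) hne
      exact ⟨a.2, by exact_mod_cast (hD a ha).2.le, fun dμ hdμ => hmax dμ hdμ⟩
    · exact ⟨0, le_rfl, fun dμ hdμ => (hne ⟨dμ, hdμ⟩).elim⟩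
  refine ⟨max (μ₁ + C) (((2 * C / μ₀) ^ 2) ^ m), μ₀ / 2, by positivity, fun K _ _ c => ?_⟩
  have hq1 : (1 : ℝ) ≤ (Fintype.card K : ℝ) := by exact_mod_cast Fintype.card_pos
  have hq0 : (0 : ℝ) < (Fintype.card K : ℝ) := by linarith
  set q : ℝ := (Fintype.card K : ℝ) with hq
  have hNle : (definableCard K φ c : ℝ) ≤ q ^ m := by
    rw [hq]; exact_mod_cast definableCard_le_card_pow K φ c
  set N : ℝ := (definableCard K φ c : ℝ) with hN
  have hN0 : 0 ≤ N := by rw [hN]; exact_mod_cast Nat.zero_le _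
  rcases hmain K c with h0 | ⟨dμ, hdμ, hest⟩
  · -- empty set
    left
    have : N = 0 := by rw [hN]; exact_mod_cast h0
    rw [this]
    exact le_max_of_le_left (by linarith)
  · obtain ⟨-, hμpos⟩ := hD dμ hdμ
    have hμ : (0 : ℝ) < (dμ.2 : ℝ) := by exact_mod_cast hμpos
    obtain ⟨hup, hlow⟩ := abs_sub_le_iff.1 hest
    -- `hup : N - μ q^d ≤ C q^(d-1/2)`, `hlow : μ q^d - N ≤ C q^(d-1/2)`
    rcases Nat.eq_zero_or_pos dμ.1 with hd0 | hdpos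
    · -- dimension 0: `N ≤ μ + C`
      left
      have hr : q ^ ((dμ.1 : ℝ) - 1 / 2) ≤ 1 := by
        apply Real.rpow_le_one_of_one_le_of_nonpos hq1
        rw [hd0]; norm_num
      have h1 : N ≤ (dμ.2 : ℝ) + C := by
        have : (dμ.2 : ℝ) * q ^ dμ.1 = dμ.2 := by rw [hd0, pow_zero, mul_one]
        nlinarith [mul_le_mul_of_nonneg_left hr hC.le]
      exact le_max_of_le_left (by linarith [hμ₁le dμ hdμ])
    · -- dimension ≥ 1
      have hsqrt : q ^ ((dμ.1 : ℝ) - 1 / 2) * q ^ (1 / 2 : ℝ) = q ^ dμ.1 := by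
        rw [← Real.rpow_add hq0, sub_add_cancel, Real.rpow_natCast]
      by_cases hbig : 2 * C / (dμ.2 : ℝ) ≤ q ^ (1 / 2 : ℝ)
      · -- large `q`: `N ≥ (μ/2) q^d ≥ (μ₀/2) q`
        right
        have hCle : C ≤ (dμ.2 : ℝ) / 2 * q ^ (1 / 2 : ℝ) := by
          have := mul_le_mul_of_nonneg_left hbig (by positivity : (0 : ℝ) ≤ dμ.2 / 2)
          calc C = (dμ.2 : ℝ) / 2 * (2 * C / dμ.2) := by field_simp
            _ ≤ (dμ.2 : ℝ) / 2 * q ^ (1 / 2 : ℝ) := this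
        have hkey : C * q ^ ((dμ.1 : ℝ) - 1 / 2) ≤ (dμ.2 : ℝ) / 2 * q ^ dμ.1 := by
          calc C * q ^ ((dμ.1 : ℝ) - 1 / 2)
              ≤ (dμ.2 : ℝ) / 2 * q ^ (1 / 2 : ℝ) * q ^ ((dμ.1 : ℝ) - 1 / 2) :=
                mul_le_mul_of_nonneg_right hCle (Real.rpow_nonneg hq0.le _)
            _ = (dμ.2 : ℝ) / 2 * q ^ dμ.1 := by rw [mul_assoc, mul_comm (q ^ (1 / 2 : ℝ)), hsqrt]
        have hqd : q ≤ q ^ dμ.1 := by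
          calc q = q ^ 1 := (pow_one q).symm
            _ ≤ q ^ dμ.1 := pow_le_pow_right₀ hq1 hdpos
        calc μ₀ / 2 * q ≤ (dμ.2 : ℝ) / 2 * q := by
              apply mul_le_mul_of_nonneg_right _ hq0.le
              linarith [hμ₀le dμ hdμ]
          _ ≤ (dμ.2 : ℝ) / 2 * q ^ dμ.1 := mul_le_mul_of_nonneg_left hqd (by positivity)
          _ = (dμ.2 : ℝ) * q ^ dμ.1 - (dμ.2 : ℝ) / 2 * q ^ dμ.1 := by ring
          _ ≤ (dμ.2 : ℝ) * q ^ dμ.1 - C * q ^ ((dμ.1 : ℝ) - 1 / 2) := by linarith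
          _ ≤ N := by linarith
      · -- small `q`: `q < (2C/μ)² ≤ (2C/μ₀)²`, so `N ≤ q^m ≤ ((2C/μ₀)²)^m`
        left
        push Not at hbig
        have hqs : q = (q ^ (1 / 2 : ℝ)) ^ 2 := by
          rw [← Real.rpow_natCast, ← Real.rpow_mul hq0.le]; norm_num
        have hqlt : q ≤ (2 * C / μ₀) ^ 2 := by
          rw [hqs]
          have h2 : q ^ (1 / 2 : ℝ) ≤ 2 * C / μ₀ := by
            calc q ^ (1 / 2 : ℝ) ≤ 2 * C / (dμ.2 : ℝ) := hbig.le
              _ ≤ 2 * C / μ₀ := by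
                apply div_le_div_of_nonneg_left (by positivity) hμ₀ (hμ₀le dμ hdμ)
          exact pow_le_pow_left₀ (Real.rpow_nonneg hq0.le _) h2 2
        calc N ≤ q ^ m := hNle
          _ ≤ ((2 * C / μ₀) ^ 2) ^ m := pow_le_pow_left₀ hq0.le hqlt m
          _ ≤ max (μ₁ + C) (((2 * C / μ₀) ^ 2) ^ m) := le_max_right _ _

open Classical in
/-- Prime-field size dichotomy in the `Finset.filter` typing of the route crux
`Summit.PneNP.PneNP.Theses.EcdlpDefinability.DefinableSizeDichotomy`: for every ring formula
`φ(x̄; ȳ)` there are `C` and `δ > 0` with `|φ(𝔽_p^m; c)| ≤ C` or `δ·p ≤ |φ(𝔽_p^m; c)|` for every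
prime `p` and all parameters `c`. [cite: ChatzidakisVanDenDriesMacintyre1992, Main Theorem] -/
theorem ChatzidakisVanDenDriesMacintyre1992_mainTheorem.card_filter_le_or_le
    (h : ChatzidakisVanDenDriesMacintyre1992_mainTheorem) (m n : ℕ)
    (φ : Language.ring.Formula (Fin m ⊕ Fin n)) :
    ∃ C δ : ℝ, 0 < δ ∧ ∀ (p : ℕ) [Fact p.Prime] (c : Fin n → ZMod p),
      (letI := compatibleRingOfRing (ZMod p);
        (((Finset.univ.filter fun x : Fin m → ZMod p => φ.Realize (Sum.elim x c)).card : ℝ) ≤ C ∨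
          δ * (p : ℝ) ≤
            ((Finset.univ.filter fun x : Fin m → ZMod p =>
              φ.Realize (Sum.elim x c)).card : ℝ))) := by
  obtain ⟨C, δ, hδ, hmain⟩ := h.card_le_or_le m n φ
  refine ⟨C, δ, hδ, fun p _ c => ?_⟩
  have h := hmain (ZMod p) c
  rw [definableCard_eq_card_filter, ZMod.card] at h
  exact h

end Literature.ModelTheory.PseudofiniteFields
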